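import Literature.MathematicalPhysics.QuantumFieldTheory.LatticeChainFourierNorms
import Literature.Analysis.FunctionSpaces.LatticeSegmentFourier
import HarnessLib

/-!
# The sheet of a rectangular Wilson loop as a real 2-chain, and its Fourier bounds

Support file (module "P4d", first part) for the lattice potential theory of the four-dimensional
`U(1)` gauge theory (proof programme of the named fact
`Literature.MathematicalPhysics.QuantumFieldTheory.FrohlichSpencerU1PerimeterLawD4`;
Fröhlich–Spencer 1982 §2.4 (the surface `S` with `∂S = ℒ`), §2.10 (2.88)). The `R × T`
rectangle of plaquettes at `x₀` in the coordinate plane `(i, j)` is encoded by the real family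
`rectInd x₀ i j R T = ∑_{s<R} 1_{seg(x₀ + s eᵢ, j, T)}` (a sum of parallel segments, so that
all identities are finite-sum bookkeeping) and the alternating real 2-tensor
`sheetT x₀ i j R T (y; k, l) = coef i j k l · rectInd(y)` (`coef = +1` on `(i,j)`, `-1` on
`(j,i)`, `0` otherwise). We prove: finite support, alternation, the transposition symmetry
`rectInd_swap`, the Fourier bound `‖rectInd^(x)‖ ≤ R T`, the **telescoping identity**
`rectInd(· - eᵢ) - rectInd = 1_{seg(x₀ + R eᵢ)} - 1_{seg(x₀)}` and the resulting bound
`‖(rectInd(· - eᵢ) - rectInd)^(x)‖² ≤ 4 ‖D_T(x_j)‖²` (and its transpose), which say that the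
boundary current of the sheet is carried by its four sides. Everything is proved; no named fact
is introduced.

## References

* J. Fröhlich, T. Spencer, Comm. Math. Phys. 83 (1982) 411–454, §2.4, §2.10 (2.88). [FrohlichSpencerCMP1982]
-/

noncomputable section

open MeasureTheory Finset Function Complex Literature.Probability.LatticeModels
open Literature.Analysis.FunctionSpaces
open Literature.Analysis.FunctionSpaces.LatticeFourier hiding e

namespace Literature.MathematicalPhysics.QuantumFieldTheory

namespace LatticeChain

open LatticeForm (e d₁ d₂)

variable {d : ℕ}

/-! ### Segments as sums of point indicators; shifts -/

/-- A segment indicator is the sum of the point indicators of its sites. [folklore] -/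
theorem segInd_eq_sum_ite (y₀ : Site d) (j : Fin d) (T : ℕ) (y : Site d) :
    segInd y₀ j T y = ∑ t ∈ Finset.range T, if y = y₀ + (t : ℤ) • e j then (1 : ℝ) else 0 := by
  classical
  unfold segInd segSites
  by_cases h : y ∈ (Finset.range T).image fun t : ℕ => y₀ + (t : ℤ) • e j
  · rw [if_pos h]
    obtain ⟨t, ht, rfl⟩ := Finset.mem_image.1 h
    rw [Finset.sum_eq_single t]
    · simp
    · intro t' _ ht'
      rw [if_neg]
      exact fun hcon => ht' (segSites_map_injective y₀ j hcon).symm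
    · exact fun hcon => (hcon ht).elim
  · rw [if_neg h]
    symm
    refine Finset.sum_eq_zero fun t ht => ?_
    rw [if_neg]
    exact fun hcon => h (Finset.mem_image.2 ⟨t, ht, hcon.symm⟩)

/-- Shifting the argument of a segment indicator shifts its base point. [folklore] -/
theorem segInd_sub (y₀ a : Site d) (j : Fin d) (T : ℕ) (y : Site d) :
    segInd y₀ j T (y - a) = segInd (y₀ + a) j T y := by
  rw [segInd_eq_sum_ite, segInd_eq_sum_ite]
  refine Finset.sum_congr rfl fun t _ => ?_
  have : (y - a = y₀ + (t : ℤ) • e j) ↔ (y = y₀ + a + (t : ℤ) • e j) := by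
    constructor
    · intro h; rw [← sub_add_cancel y a, h]; abel
    · intro h; rw [h]; abel
  rw [if_congr this rfl rfl]

/-! ### The rectangle and the sheet -/

/-- **The rectangle** of `R × T` sites at `x₀` in the plane `(i, j)`, as the sum of its `R` rows
(segments of `T` sites in direction `j`). [folklore] -/
def rectInd (x₀ : Site d) (i j : Fin d) (R T : ℕ) : Site d → ℝ :=
  fun y => ∑ s ∈ Finset.range R, segInd (x₀ + (s : ℤ) • e i) j T y

/-- The rectangle as a double sum of point indicators. [folklore] -/
theorem rectInd_eq_sum_sum (x₀ : Site d) (i j : Fin d) (R T : ℕ) (y : Site d) :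
    rectInd x₀ i j R T y = ∑ s ∈ Finset.range R, ∑ t ∈ Finset.range T,
      if y = x₀ + (s : ℤ) • e i + (t : ℤ) • e j then (1 : ℝ) else 0 := by
  simp only [rectInd, segInd_eq_sum_ite]

/-- **Transposition symmetry**: the rectangle in the plane `(i,j)` with sides `R, T` is the
rectangle in the plane `(j,i)` with sides `T, R`. [folklore] -/
theorem rectInd_swap (x₀ : Site d) (i j : Fin d) (R T : ℕ) :
    rectInd x₀ i j R T = rectInd x₀ j i T R := by
  funext y
  rw [rectInd_eq_sum_sum, rectInd_eq_sum_sum, Finset.sum_comm]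
  refine Finset.sum_congr rfl fun t _ => Finset.sum_congr rfl fun s _ => ?_
  rw [add_right_comm]

/-- The rectangle family is finitely supported. [folklore] -/
theorem hasFiniteSupport_rectInd (x₀ : Site d) (i j : Fin d) (R T : ℕ) :
    HasFiniteSupport (rectInd x₀ i j R T) :=
  Function.HasFiniteSupport.sum (fun _ => hasFiniteSupport_segInd _ j T) (Finset.range R)

/-- The crude pointwise bound `|rectInd y| ≤ R`. [folklore] -/
theorem abs_rectInd_le (x₀ : Site d) (i j : Fin d) (R T : ℕ) (y : Site d) :
    |rectInd x₀ i j R T y| ≤ R := by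
  unfold rectInd
  refine (Finset.abs_sum_le_sum_abs _ _).trans ?_
  have h : ∀ s ∈ Finset.range R, |segInd (x₀ + (s : ℤ) • e i) j T y| ≤ 1 := fun s _ => by
    unfold segInd; split_ifs <;> simp
  refine (Finset.sum_le_sum h).trans ?_
  simp

/-- The coefficient pattern of the sheet: `+1` on `(i,j)`, `-1` on `(j,i)`, `0` otherwise. [folklore] -/
def coef (i j k l : Fin d) : ℝ := if k = i ∧ l = j then 1 else if k = j ∧ l = i then -1 else 0

/-- `|coef| ≤ 1`. [folklore] -/
theorem abs_coef_le (i j k l : Fin d) : |coef i j k l| ≤ 1 := by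
  unfold coef; split_ifs <;> simp

/-- `coef` is alternating when `i ≠ j`. [folklore] -/
theorem coef_swap {i j : Fin d} (hij : i ≠ j) (k l : Fin d) : coef i j l k = -coef i j k l := by
  unfold coef
  by_cases h1 : k = i <;> by_cases h2 : l = j <;> by_cases h3 : k = j <;> by_cases h4 : l = i <;>
    simp_all

/-- **The sheet** of the `R × T` Wilson loop at `x₀` in the plane `(i,j)` as an alternating real
2-tensor: `σ(y; k, l) = coef i j k l · rectInd(y)`. [cite: FrohlichSpencerCMP1982, §2.4 (the surface S, ∂S = ℒ)] -/
def sheetT (x₀ : Site d) (i j : Fin d) (R T : ℕ) : Site d → Fin d → Fin d → ℝ :=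
  fun y k l => coef i j k l * rectInd x₀ i j R T y

/-- The sheet is finitely supported. [folklore] -/
theorem hasFiniteSupport_sheetT (x₀ : Site d) (i j : Fin d) (R T : ℕ) :
    HasFiniteSupport (sheetT x₀ i j R T) :=
  hasFiniteSupport_of_imp (hasFiniteSupport_rectInd x₀ i j R T) fun y h0 => by
    funext k l; simp [sheetT, h0]

/-- The sheet is alternating (`i ≠ j`). [folklore] -/
theorem isAltR₂_sheetT (x₀ : Site d) {i j : Fin d} (hij : i ≠ j) (R T : ℕ) :
    IsAltR₂ (sheetT x₀ i j R T) := fun y k l => by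
  simp only [sheetT, coef_swap hij k l, neg_mul]

/-! ### Fourier bounds for the rectangle -/

/-- `‖rectInd^(x)‖ ≤ R T`. [folklore] -/
theorem norm_latF_rectInd_le (x₀ : Site d) (i j : Fin d) (R T : ℕ) (x : UnitAddTorus (Fin d)) :
    ‖latF (rectInd x₀ i j R T) x‖ ≤ R * T := by
  have h1 : latF (rectInd x₀ i j R T) x =
      ∑ s ∈ Finset.range R, latF (segInd (x₀ + (s : ℤ) • e i) j T) x :=
    latF_finset_sum (Finset.range R) (fun s _ => hasFiniteSupport_segInd _ j T) x
  rw [h1]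
  refine (norm_sum_le _ _).trans ?_
  have h2 : ∀ s ∈ Finset.range R, ‖latF (segInd (x₀ + (s : ℤ) • e i) j T) x‖ ≤ T := fun s _ => by
    rw [latF_eq_latFT (support_segInd _ j T), norm_latFT_segInd]
    unfold dirichletSum
    refine (norm_sum_le _ _).trans ?_
    have : ∀ t ∈ Finset.range T, ‖(fourier (t : ℤ) (x j) : ℂ)‖ ≤ 1 := fun t _ => by
      rw [fourier_apply, Circle.norm_coe]
    refine (Finset.sum_le_sum this).trans ?_
    simp
  refine (Finset.sum_le_sum h2).trans ?_
  simp

/-- **Telescoping**: `rectInd(y - eᵢ) - rectInd(y) = 1_{seg(x₀ + R eᵢ)}(y) - 1_{seg(x₀)}(y)`. [folklore] -/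
theorem rectInd_sub_e_sub (x₀ : Site d) (i j : Fin d) (R T : ℕ) (y : Site d) :
    rectInd x₀ i j R T (y - e i) - rectInd x₀ i j R T y =
      segInd (x₀ + (R : ℤ) • e i) j T y - segInd x₀ j T y := by
  unfold rectInd
  simp only [segInd_sub]
  have h : ∀ s : ℕ, x₀ + (s : ℤ) • e i + e i = x₀ + ((s + 1 : ℕ) : ℤ) • e i := fun s => by
    push_cast; rw [add_smul, one_smul, add_assoc]
  simp only [h, ← Finset.sum_sub_distrib]
  rw [Finset.sum_range_sub (fun s => segInd (x₀ + (s : ℤ) • e i) j T y) R]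
  simp

/-- **The side bound**: `‖(rectInd(· - eᵢ) - rectInd)^(x)‖² ≤ 4 ‖D_T(x_j)‖²`. [folklore] -/
theorem norm_sq_latF_rectInd_diff_le (x₀ : Site d) (i j : Fin d) (R T : ℕ) (x : UnitAddTorus (Fin d)) :
    ‖latF (fun y => rectInd x₀ i j R T (y - e i) - rectInd x₀ i j R T y) x‖ ^ 2 ≤
      4 * ‖dirichletSum T (x j)‖ ^ 2 := by
  have h1 : (fun y => rectInd x₀ i j R T (y - e i) - rectInd x₀ i j R T y) =
      segInd (x₀ + (R : ℤ) • e i) j T - segInd x₀ j T := by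
    funext y; rw [Pi.sub_apply, rectInd_sub_e_sub]
  rw [h1, latF_sub (hasFiniteSupport_segInd _ j T) (hasFiniteSupport_segInd _ j T), Pi.sub_apply,
    latF_eq_latFT (support_segInd _ j T), latF_eq_latFT (support_segInd x₀ j T)]
  have ha := norm_latFT_segInd (x₀ + (R : ℤ) • e i) j T x
  have hb := norm_latFT_segInd x₀ j T x
  have h2 := norm_sub_le (latFT (segSites (x₀ + (R : ℤ) • e i) j T) (segInd (x₀ + (R : ℤ) • e i) j T) x)
    (latFT (segSites x₀ j T) (segInd x₀ j T) x)
  rw [ha, hb] at h2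
  have h3 := pow_le_pow_left₀ (norm_nonneg _) h2 2
  nlinarith [norm_nonneg (dirichletSum T (x j))]

/-- The transposed side bound: `‖(rectInd(· - eⱼ) - rectInd)^(x)‖² ≤ 4 ‖D_R(x_i)‖²`. [folklore] -/
theorem norm_sq_latF_rectInd_diff_le' (x₀ : Site d) (i j : Fin d) (R T : ℕ) (x : UnitAddTorus (Fin d)) :
    ‖latF (fun y => rectInd x₀ i j R T (y - e j) - rectInd x₀ i j R T y) x‖ ^ 2 ≤
      4 * ‖dirichletSum R (x i)‖ ^ 2 := by
  rw [rectInd_swap]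
  exact norm_sq_latF_rectInd_diff_le x₀ j i T R x

/-! ### The boundary current `J = ∂σ` of the sheet -/

/-- The backward difference of the rectangle in direction `a`. [folklore] -/
def rectDiff (x₀ : Site d) (i j : Fin d) (R T : ℕ) (a : Fin d) : Site d → ℝ :=
  fun y => rectInd x₀ i j R T (y - e a) - rectInd x₀ i j R T y

/-- `rectDiff` is finitely supported. [folklore] -/
theorem hasFiniteSupport_rectDiff (x₀ : Site d) (i j : Fin d) (R T : ℕ) (a : Fin d) :
    HasFiniteSupport (rectDiff x₀ i j R T a) :=
  (hasFiniteSupport_comp_sub (hasFiniteSupport_rectInd x₀ i j R T) (e a)).sub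
    (hasFiniteSupport_rectInd x₀ i j R T)

/-- For `i ≠ j`, `coef` splits into two exclusive indicators. [folklore] -/
theorem coef_eq_ite_sub_ite {i j : Fin d} (hij : i ≠ j) (k l : Fin d) :
    coef i j k l = (if k = i ∧ l = j then (1 : ℝ) else 0) - (if k = j ∧ l = i then 1 else 0) := by
  unfold coef
  by_cases h1 : k = i ∧ l = j
  · have h2 : ¬ (k = j ∧ l = i) := fun h => hij (h1.1.symm.trans h.1)
    rw [if_pos h1, if_pos h1, if_neg h2]; norm_num
  · by_cases h2 : k = j ∧ l = i
    · rw [if_neg h1, if_pos h2, if_neg h1, if_pos h2]; norm_num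
    · rw [if_neg h1, if_neg h2, if_neg h1, if_neg h2]; norm_num

/-- `∑_{j'} coef(j', k) b(j') = [k = j] b(i) - [k = i] b(j)` (`i ≠ j`). [folklore] -/
theorem sum_coef_mul {i j : Fin d} (hij : i ≠ j) (k : Fin d) (b : Fin d → ℝ) :
    ∑ j', coef i j j' k * b j' = (if k = j then b i else 0) - (if k = i then b j else 0) := by
  simp only [coef_eq_ite_sub_ite hij, sub_mul, Finset.sum_sub_distrib, ite_mul, one_mul, zero_mul]
  congr 1
  · by_cases hk : k = j
    · simp [hk]
    · simp [hk]
  · by_cases hk : k = i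
    · simp [hk]
    · simp [hk]

/-- **The boundary current of the sheet**: `(∂σ)(y, k) = [k = j] rectDiff_i(y) - [k = i] rectDiff_j(y)`:
two sides of length `T` (direction `j`) and two of length `R` (direction `i`). [cite: FrohlichSpencerCMP1982, §2.4 (∂S = ℒ)] -/
theorem div₂_sheetT_apply (x₀ : Site d) {i j : Fin d} (hij : i ≠ j) (R T : ℕ) (y : Site d) (k : Fin d) :
    div₂ (sheetT x₀ i j R T) y k =
      (if k = j then rectDiff x₀ i j R T i y else 0) - (if k = i then rectDiff x₀ i j R T j y else 0) := by
  simp only [div₂, sheetT, ← mul_sub]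
  rw [sum_coef_mul hij k fun j' => rectInd x₀ i j R T (y - e j') - rectInd x₀ i j R T y]
  rfl

/-- `∂σ` is finitely supported. [folklore] -/
theorem hasFiniteSupport_div₂_sheetT (x₀ : Site d) (i j : Fin d) (R T : ℕ) :
    HasFiniteSupport (div₂ (sheetT x₀ i j R T)) :=
  hasFiniteSupport_of_imp_sub (hasFiniteSupport_sheetT x₀ i j R T) fun y h0 h1 => by
    funext k
    simp only [div₂, Pi.zero_apply]
    exact Finset.sum_eq_zero fun j' _ => by rw [h0, h1 j']; simp

/-- The components of `∂σ` as functions. [folklore] -/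
theorem div₂_sheetT_component (x₀ : Site d) {i j : Fin d} (hij : i ≠ j) (R T : ℕ) (k : Fin d) :
    (fun y => div₂ (sheetT x₀ i j R T) y k) =
      (if k = j then rectDiff x₀ i j R T i else 0) - (if k = i then rectDiff x₀ i j R T j else 0) := by
  funext y
  rw [div₂_sheetT_apply x₀ hij R T y k, Pi.sub_apply]
  congr 1 <;> split_ifs <;> rfl

/-- **The sides carry the current**: `∑ₖ ‖(∂σ)ₖ^(x)‖² ≤ 4 ‖D_T(x_j)‖² + 4 ‖D_R(x_i)‖²`. [folklore] -/
theorem sum_norm_sq_latF_div₂_sheetT_le (x₀ : Site d) {i j : Fin d} (hij : i ≠ j) (R T : ℕ)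
    (x : UnitAddTorus (Fin d)) :
    ∑ k, ‖latF (fun y => div₂ (sheetT x₀ i j R T) y k) x‖ ^ 2 ≤
      4 * ‖dirichletSum T (x j)‖ ^ 2 + 4 * ‖dirichletSum R (x i)‖ ^ 2 := by
  have hval : ∀ k, ‖latF (fun y => div₂ (sheetT x₀ i j R T) y k) x‖ ^ 2 =
      (if k = j then ‖latF (rectDiff x₀ i j R T i) x‖ ^ 2 else 0) +
        (if k = i then ‖latF (rectDiff x₀ i j R T j) x‖ ^ 2 else 0) := by
    intro k
    rw [div₂_sheetT_component x₀ hij R T k]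
    by_cases hkj : k = j
    · have hki : k ≠ i := fun h => hij (h.symm.trans hkj)
      simp only [hkj, if_true, if_neg (show ¬ j = i from fun h => hij h.symm), sub_zero, add_zero]
    · by_cases hki : k = i
      · simp only [hki, if_neg hij, if_true, zero_sub, zero_add]
        rw [show latF (-rectDiff x₀ i j R T j) x = -latF (rectDiff x₀ i j R T j) x by
          have h := latF_sub (show HasFiniteSupport (0 : Site d → ℝ) from by
            simp [Function.HasFiniteSupport]) (hasFiniteSupport_rectDiff x₀ i j R T j)
          simp only [zero_sub] at h
          rw [h]
          simp [latF], norm_neg]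
      · simp only [if_neg hkj, if_neg hki, sub_zero, add_zero]
        simp [latF]
  simp only [hval, Finset.sum_add_distrib, Finset.sum_ite_eq', Finset.mem_univ, if_true]
  have h1 : ‖latF (rectDiff x₀ i j R T i) x‖ ^ 2 ≤ 4 * ‖dirichletSum T (x j)‖ ^ 2 :=
    norm_sq_latF_rectInd_diff_le x₀ i j R T x
  have h2 : ‖latF (rectDiff x₀ i j R T j) x‖ ^ 2 ≤ 4 * ‖dirichletSum R (x i)‖ ^ 2 :=
    norm_sq_latF_rectInd_diff_le' x₀ i j R T x
  linarith

/-- `‖rectDiff_a^(x)‖² = ‖𝐞(x_a) - 1‖² ‖rectInd^(x)‖²`. [folklore] -/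
theorem norm_sq_latF_rectDiff (x₀ : Site d) (i j : Fin d) (R T : ℕ) (a : Fin d)
    (x : UnitAddTorus (Fin d)) :
    ‖latF (rectDiff x₀ i j R T a) x‖ ^ 2 =
      ‖(fourier 1 (x a) : ℂ) - 1‖ ^ 2 * ‖latF (rectInd x₀ i j R T) x‖ ^ 2 := by
  classical
  have hs := hasFiniteSupport_rectInd x₀ i j R T
  have h1 : rectDiff x₀ i j R T a = (fun y => rectInd x₀ i j R T (y - e a)) - rectInd x₀ i j R T := rfl
  rw [h1, latF_sub (hasFiniteSupport_comp_sub hs (e a)) hs, Pi.sub_apply, latF_comp_sub hs,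
    ← sub_one_mul, norm_mul, mul_pow, UnitAddTorus.mFourier_single]

/-- `∑ₖ ‖(∂σ)ₖ^(x)‖² ≤ μ(x) (R T)²` (`i ≠ j`). [folklore] -/
theorem sum_norm_sq_latF_div₂_sheetT_le_dispersion (x₀ : Site d) {i j : Fin d} (hij : i ≠ j) (R T : ℕ)
    (x : UnitAddTorus (Fin d)) :
    ∑ k, ‖latF (fun y => div₂ (sheetT x₀ i j R T) y k) x‖ ^ 2 ≤
      latticeDispersion x * ((R : ℝ) * T) ^ 2 := by
  have hval : ∑ k, ‖latF (fun y => div₂ (sheetT x₀ i j R T) y k) x‖ ^ 2 =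
      ‖latF (rectDiff x₀ i j R T i) x‖ ^ 2 + ‖latF (rectDiff x₀ i j R T j) x‖ ^ 2 := by
    have hc : ∀ k, ‖latF (fun y => div₂ (sheetT x₀ i j R T) y k) x‖ ^ 2 =
        (if k = j then ‖latF (rectDiff x₀ i j R T i) x‖ ^ 2 else 0) +
          (if k = i then ‖latF (rectDiff x₀ i j R T j) x‖ ^ 2 else 0) := by
      intro k
      rw [div₂_sheetT_component x₀ hij R T k]
      by_cases hkj : k = j
      · simp only [hkj, if_true, if_neg (show ¬ j = i from fun h => hij h.symm), sub_zero, add_zero]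
      · by_cases hki : k = i
        · simp only [hki, if_neg hij, if_true, zero_sub, zero_add]
          rw [show latF (-rectDiff x₀ i j R T j) x = -latF (rectDiff x₀ i j R T j) x by
            have h := latF_sub (show HasFiniteSupport (0 : Site d → ℝ) from by
              simp [Function.HasFiniteSupport]) (hasFiniteSupport_rectDiff x₀ i j R T j)
            simp only [zero_sub] at h
            rw [h]
            simp [latF], norm_neg]
        · simp only [if_neg hkj, if_neg hki, sub_zero, add_zero]
          simp [latF]
    simp only [hc, Finset.sum_add_distrib, Finset.sum_ite_eq', Finset.mem_univ, if_true]
  rw [hval, norm_sq_latF_rectDiff, norm_sq_latF_rectDiff, ← add_mul]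
  have hω : ‖(fourier 1 (x i) : ℂ) - 1‖ ^ 2 + ‖(fourier 1 (x j) : ℂ) - 1‖ ^ 2 ≤ latticeDispersion x := by
    unfold latticeDispersion
    rw [← Finset.sum_pair (f := fun k => ‖(fourier 1 (x k) : ℂ) - 1‖ ^ 2) hij]
    exact Finset.sum_le_sum_of_subset_of_nonneg (Finset.subset_univ _) fun k _ _ => sq_nonneg _
  have hs : ‖latF (rectInd x₀ i j R T) x‖ ^ 2 ≤ ((R : ℝ) * T) ^ 2 :=
    pow_le_pow_left₀ (norm_nonneg _) (norm_latF_rectInd_le x₀ i j R T x) 2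
  exact mul_le_mul hω hs (sq_nonneg _) (latticeDispersion_nonneg x)

end LatticeChain

end Literature.MathematicalPhysics.QuantumFieldTheory
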